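import Mathlib

/-!
# `DivisionGap.PerMultiplesHard` (stmt-ValiantsHypothesis-5068), line `uncharged-face-walk`:
deficit accounting for a block of a table (stub `stub_blockMargins`)

Pure finite-sum bookkeeping for the block-slice descent.  A table `M₀ : (Fin n × Fin n) →₀ ℕ`
(cells `(row, col)`) has row sums `R` and column sums `C`; a block of rows `A` and columns `B`,
both of size `a`, is enumerated by `eA : Fin a ≃ A`, `eB : Fin a ≃ B`, and `r, c` are the block
margins (sums of `M₀` over the block, transported to `Fin a`).  With the row deficits
`d x := ∑ j ∈ Bᶜ, M₀ (eA x, j)` (mass of row `eA x` outside the columns `B`) and the column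
deficits `e y := ∑ i ∈ Aᶜ, M₀ (i, eB y)` one has `r x + d x = R (eA x)`, `c y + e y = C (eB y)`,
and `Σ d + Σ e + (block-diagonal mass) = Σ R`: the four cell classes `A × B`, `A × Bᶜ`, `Aᶜ × B`,
`Aᶜ × Bᶜ` partition `Fin n × Fin n`, `Σ d` is the mass on `A × Bᶜ`, `Σ e` the mass on `Aᶜ × B`,
and the degree of `M₀` filtered by `e.1 ∈ A ↔ e.2 ∈ B` is the mass on `A × B` plus the mass on
`Aᶜ × Bᶜ`.

Log (stub-worker): Mathlib only (`Finset.sum_add_sum_compl`, `Finset.sum_coe_sort`,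
`Equiv.sum_comp`, `Finsupp.degree_eq_sum`, `Finsupp.filter_apply`, `Fintype.sum_prod_type`).
[folklore]
-/

noncomputable section

set_option linter.dupNamespace false

open scoped BigOperators

namespace Summit.ValiantsHypothesis.ValiantsHypothesis.Theorems.DivisionGap.PerMultiplesHard.BlockMargins

/-! ### Finite-sum bookkeeping -/

/-- Transport of a sum over `Fin a` along an enumeration `eA : Fin a ≃ A` of a finset `A`:
`∑ x, g (eA x) = ∑ i ∈ A, g i`. [folklore] -/
theorem sum_equiv_finset {n a : ℕ} (A : Finset (Fin n)) (eA : Fin a ≃ {x // x ∈ A})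
    (g : Fin n → ℕ) : ∑ x, g (eA x : Fin n) = ∑ i ∈ A, g i := by
  rw [← Finset.sum_coe_sort A g]
  exact eA.sum_comp (fun i : {x // x ∈ A} => g i)

/-- The degree (total mass) of a filtered finsupp over a fintype is the sum, over all points, of
the values at the points satisfying the predicate. [folklore] -/
theorem degree_filter_eq_sum_ite {ι : Type*} [Fintype ι] (f : ι →₀ ℕ) (P : ι → Prop)
    [DecidablePred P] : (f.filter P).degree = ∑ e, if P e then f e else 0 := by
  rw [Finsupp.degree_eq_sum]
  rfl

/-- The mass of a table on a block `S × T`, as a sum over all cells of an indicator-weighted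
table. [folklore] -/
theorem sum_block_eq_sum_ite {n : ℕ} (S T : Finset (Fin n)) (f : Fin n × Fin n → ℕ) :
    ∑ i ∈ S, ∑ j ∈ T, f (i, j) = ∑ i, ∑ j, if i ∈ S ∧ j ∈ T then f (i, j) else 0 := by
  rw [← Finset.sum_ite_mem_eq S]
  refine Finset.sum_congr rfl fun i _ => ?_
  split_ifs with hi
  · rw [← Finset.sum_ite_mem_eq T]
    exact Finset.sum_congr rfl fun j _ => by simp [hi]
  · exact (Finset.sum_eq_zero fun j _ => by simp [hi]).symm

/-- **The four cell classes partition the table.** The mass on `A × Bᶜ`, plus the mass on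
`Aᶜ × B`, plus the block-diagonal mass (cells with `row ∈ A ↔ col ∈ B`, i.e. `A × B` together
with `Aᶜ × Bᶜ`) is the total mass. [folklore] -/
theorem mass_split {n : ℕ} (A B : Finset (Fin n)) (f : Fin n × Fin n → ℕ) :
    (∑ i ∈ A, ∑ j ∈ Bᶜ, f (i, j)) + (∑ j ∈ B, ∑ i ∈ Aᶜ, f (i, j)) +
      (∑ e, if (e.1 ∈ A ↔ e.2 ∈ B) then f e else 0) = ∑ e, f e := by
  have hT : ∑ j ∈ B, ∑ i ∈ Aᶜ, f (i, j) = ∑ i ∈ Aᶜ, ∑ j ∈ B, f (i, j) := Finset.sum_comm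
  rw [hT, sum_block_eq_sum_ite A Bᶜ f, sum_block_eq_sum_ite Aᶜ B f, Fintype.sum_prod_type,
    Fintype.sum_prod_type, ← Finset.sum_add_distrib, ← Finset.sum_add_distrib]
  refine Finset.sum_congr rfl fun i _ => ?_
  rw [← Finset.sum_add_distrib, ← Finset.sum_add_distrib]
  refine Finset.sum_congr rfl fun j _ => ?_
  by_cases hi : i ∈ A <;> by_cases hj : j ∈ B <;> simp [hi, hj]

/-! ### The stub -/

/-- **Deficit accounting for the block of a table** (stub `stub_blockMargins` of line
`uncharged-face-walk`).  For a table `M₀` with row sums `R`, column sums `C`, a block of rows `A`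
and columns `B` enumerated by `eA`, `eB`, and block margins `r`, `c`, the row deficits
`d x := ∑ j ∈ Bᶜ, M₀ (eA x, j)` and column deficits `e y := ∑ i ∈ Aᶜ, M₀ (i, eB y)` complete the
block margins to the full margins, and `Σ d + Σ e +` (block-diagonal mass of `M₀`) `= Σ R`.
[folklore] -/
theorem stub_blockMargins :
    ∀ (n a : ℕ) (A B : Finset (Fin n)) (eA : Fin a ≃ {x // x ∈ A}) (eB : Fin a ≃ {x // x ∈ B})
      (M₀ : (Fin n × Fin n) →₀ ℕ) (R C : Fin n → ℕ) (r c : Fin a → ℕ),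
      (∀ i, ∑ j, M₀ (i, j) = R i) → (∀ j, ∑ i, M₀ (i, j) = C j) →
      (∀ x : Fin a, r x = ∑ y, M₀ ((eA x : Fin n), (eB y : Fin n))) →
      (∀ y : Fin a, c y = ∑ x, M₀ ((eA x : Fin n), (eB y : Fin n))) →
      ∃ d e : Fin a → ℕ, (∀ x, r x + d x = R (eA x : Fin n)) ∧ (∀ y, c y + e y = C (eB y : Fin n)) ∧
        (∑ x, d x) + (∑ y, e y) + (M₀.filter (fun e : Fin n × Fin n => (e.1 ∈ A ↔ e.2 ∈ B))).degree = ∑ i, R i := by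
  intro n a A B eA eB M₀ R C r c hR hC hr hc
  refine ⟨fun x => ∑ j ∈ Bᶜ, M₀ ((eA x : Fin n), j), fun y => ∑ i ∈ Aᶜ, M₀ (i, (eB y : Fin n)),
    fun x => ?_, fun y => ?_, ?_⟩
  · -- row `eA x`: block part `r x` plus the deficit is the full row sum
    rw [hr x, ← hR, sum_equiv_finset B eB (fun j => M₀ ((eA x : Fin n), j))]
    exact Finset.sum_add_sum_compl B _
  · -- column `eB y`: block part `c y` plus the deficit is the full column sum
    rw [hc y, ← hC, sum_equiv_finset A eA (fun i => M₀ (i, (eB y : Fin n)))]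
    exact Finset.sum_add_sum_compl A _
  · -- total mass: the four cell classes partition the table
    rw [sum_equiv_finset A eA (fun i => ∑ j ∈ Bᶜ, M₀ (i, j)),
      sum_equiv_finset B eB (fun j => ∑ i ∈ Aᶜ, M₀ (i, j)), degree_filter_eq_sum_ite,
      mass_split A B M₀, Fintype.sum_prod_type]
    exact Finset.sum_congr rfl fun i _ => hR i

end Summit.ValiantsHypothesis.ValiantsHypothesis.Theorems.DivisionGap.PerMultiplesHard.BlockMargins

end
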